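import Literature.Analysis.Complex.BernsteinLaxInequalities
import HarnessLib

/-!
# Growth of polynomials outside the unit disk, `‖p‖_D ≥ max |a_k|`, and the Ankeny–Rivlin inequality

Topic `Literature/Analysis/Complex`, namespace `Literature.Analysis.Complex.PolynomialGrowthUnitDisk`;
sequel of `BernsteinLaxInequalities.lean` (Bernstein's inequality, Lax's theorem).

Source: P. Borwein – T. Erdélyi, *Polynomials and Polynomial Inequalities* (GTM 161, Springer 1995)
[BorweinErdelyi1995]:

* §2.1 **E.8 «Lower Bound for the Norm of Polynomials on the Unit Disk»**:
  `‖a₀ + a₁z + ⋯ + aₙzⁿ‖_D ≥ max_k |a_k|` — «Thus zⁿ plays the role of the nth Chebyshev polynomial on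
  the unit disk» (`norm_coeff_le`, `one_le_of_monic`). The printed hint is Cauchy's coefficient formula;
  here Mathlib's Cauchy estimate `Complex.norm_iteratedDeriv_le_of_forall_mem_sphere_norm_le` is used,
  with `p^{(k)}(0) = k!·a_k` (`iteratedDeriv_eval`, `iteratedDeriv_eval_zero`).
* §5.1 **E.17 a] «Growth of Polynomials in the Complex Plane»**: `|p(z)| ≤ |z|ⁿ‖p‖_D` for
  `p ∈ 𝒫ₙᶜ`, `|z| > 1` (`norm_eval_le_pow_mul`), by the printed hint: the maximum principle applied to
  `q(z) := zⁿp(z⁻¹)` (Mathlib's `Polynomial.reflect`, `eval₂_reflect_mul_pow`); consequently the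
  EXTERIOR BERNSTEIN INEQUALITY `|p'(z)| ≤ n|z|ⁿ⁻¹‖p‖_D` for `|z| ≥ 1` (`norm_derivative_le_pow_mul`,
  E.17 a] applied to `p'` and Cor. 5.1.6).
* App. A5 **E.16 d] «An Inequality of Ankeny and Rivlin»**: for `p ∈ 𝒫ₙᶜ` with no zeros in the open
  unit disk and `r ≥ 1`, `max_{|z|=r} |p(z)| ≤ (rⁿ + 1)/2 · max_{|z|=1} |p(z)|` (`ankenyRivlin`). The book
  cites Ankeny–Rivlin [55] for the proof; the classical proof is formalised: Lax's theorem gives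
  `‖p'‖_D ≤ (n/2)‖p‖_D`, E.17 a] for `p'` gives `|p'(tu)| ≤ (n/2)‖p‖ tⁿ⁻¹` (`t ≥ 1`, `|u| = 1`), and
  `p(ru) − p(u) = ∫₁ʳ u p'(tu) dt` (`intervalIntegral.integral_eq_sub_of_hasDerivAt`) is at most
  `(n/2)‖p‖ ∫₁ʳ tⁿ⁻¹ dt = ‖p‖(rⁿ − 1)/2` in modulus.

Conventions as in the prequel: `‖p‖_D` enters as a hypothesis `hM : ∀ w, ‖w‖ = 1 → ‖p.eval w‖ ≤ M`
(any `M ≥ ‖p‖_D`), `p ∈ 𝒫ₙᶜ` is `p.natDegree ≤ n`. Not formalised: the equality case of E.17 a]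
(`p = czⁿ`), E.17 b]–c] (growth on ellipses, Bernstein–Walsh for `[−1, 1]`).

## References

* [BorweinErdelyi1995] P. Borwein, T. Erdélyi, *Polynomials and Polynomial Inequalities*, GTM 161,
  Springer 1995: §2.1 E.8 (p. 36), §5.1 E.17 a] (p. 239), App. A5 E.16 d] (p. 439)
  (held: `book:borwein1995-polynomials-polynomial-inequalities`, p0026, p0163, p0290).
-/

noncomputable section

open Polynomial Complex Metric Set Finset intervalIntegral

namespace Literature.Analysis.Complex.PolynomialGrowthUnitDisk

open Literature.Analysis.Complex.BernsteinLaxInequalities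

variable {p : ℂ[X]}

/-! ## §2.1 E.8: `‖p‖_D ≥ max_k |a_k|` -/

/-- The iterated derivative of `z ↦ p(z)` is `z ↦ p^{(k)}(z)`. [folklore] -/
private theorem iteratedDeriv_eval (p : ℂ[X]) (k : ℕ) :
    iteratedDeriv k (fun z : ℂ => p.eval z) = fun z : ℂ => (derivative^[k] p).eval z := by
  induction k generalizing p with
  | zero => simp
  | succ k ih =>
    rw [iteratedDeriv_succ', Function.iterate_succ_apply]
    have hd : deriv (fun z : ℂ => p.eval z) = fun z : ℂ => p.derivative.eval z :=
      funext fun z => Polynomial.deriv p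
    rw [hd, ih]

/-- `p^{(k)}(0) = k! · a_k`. [folklore] -/
private theorem iteratedDeriv_eval_zero (p : ℂ[X]) (k : ℕ) :
    iteratedDeriv k (fun z : ℂ => p.eval z) 0 = (k.factorial : ℂ) * p.coeff k := by
  rw [iteratedDeriv_eval]
  dsimp only
  rw [← coeff_zero_eq_eval_zero, coeff_iterate_derivative, zero_add, Nat.descFactorial_self,
    nsmul_eq_mul]

/-- **Borwein–Erdélyi §2.1 E.8 (lower bound for the norm on the unit disk):** if `|p| ≤ M` on the unit
circle then every coefficient satisfies `|a_k| ≤ M`; i.e. `‖a₀ + ⋯ + aₙzⁿ‖_D ≥ max_k |a_k|`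
(Cauchy's estimate `|p^{(k)}(0)| ≤ k!·M`). [cite: BorweinErdelyi1995, §2.1 E.8 (p. 36)] -/
theorem norm_coeff_le {M : ℝ} (hM : ∀ w : ℂ, ‖w‖ = 1 → ‖p.eval w‖ ≤ M) (k : ℕ) :
    ‖p.coeff k‖ ≤ M := by
  have hd : DiffContOnCl ℂ (fun z : ℂ => p.eval z) (ball (0 : ℂ) 1) :=
    (Polynomial.differentiable p).diffContOnCl
  have h := Complex.norm_iteratedDeriv_le_of_forall_mem_sphere_norm_le (f := fun z : ℂ => p.eval z)
    k one_pos hd (C := M) (fun z hz => hM z (by simpa using hz))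
  rw [iteratedDeriv_eval_zero, one_pow, div_one, norm_mul, Complex.norm_natCast] at h
  have hk : (0 : ℝ) < k.factorial := by exact_mod_cast k.factorial_pos
  exact le_of_mul_le_mul_left h hk

/-- **«zⁿ plays the role of the nth Chebyshev polynomial on the unit disk»:** a MONIC polynomial has
`‖p‖_D ≥ 1 = ‖zⁿ‖_D`. [cite: BorweinErdelyi1995, §2.1 E.8 (p. 36)] -/
theorem one_le_of_monic (hp : p.Monic) {M : ℝ} (hM : ∀ w : ℂ, ‖w‖ = 1 → ‖p.eval w‖ ≤ M) :
    1 ≤ M := by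
  have h := norm_coeff_le hM p.natDegree
  rwa [coeff_natDegree, hp.leadingCoeff, norm_one] at h

/-! ## §5.1 E.17 a]: growth outside the disk -/

/-- The reversed polynomial `q = reflect n p` (`q(z) = zⁿp(1/z)`) satisfies `|q| ≤ ‖p‖_D` on the unit
circle (indeed `|q(u)| = |p(ū)|`). [cite: BorweinErdelyi1995, §5.1 E.17 a] hint «q(z) := zⁿp(z⁻¹) ∈ 𝒫ₙᶜ» (p. 239)] -/
theorem norm_reflect_eval_le {n : ℕ} (hpn : p.natDegree ≤ n) {M : ℝ}
    (hM : ∀ w : ℂ, ‖w‖ = 1 → ‖p.eval w‖ ≤ M) {u : ℂ} (hu : ‖u‖ = 1) :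
    ‖(p.reflect n).eval u‖ ≤ M := by
  have hu0 : u ≠ 0 := by rintro rfl; simp at hu
  letI : Invertible u⁻¹ := invertibleOfNonzero (inv_ne_zero hu0)
  have key := eval₂_reflect_mul_pow (RingHom.id ℂ) u⁻¹ n p hpn
  rw [invOf_eq_inv, inv_inv, eval₂_id, eval₂_id] at key
  have hn : ‖(p.reflect n).eval u‖ = ‖p.eval u⁻¹‖ := by
    have := congrArg (fun z : ℂ => ‖z‖) key
    simpa [norm_mul, norm_pow, norm_inv, hu] using this
  rw [hn]
  exact hM _ (by rw [norm_inv, hu, inv_one])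

/-- **Borwein–Erdélyi §5.1 E.17 a] (growth of polynomials outside the unit disk):** for `p` of degree
at most `n` with `|p| ≤ M` on the unit circle, `|p(z)| ≤ |z|ⁿ·M` for every `|z| ≥ 1` — by the maximum
principle for `q(z) = zⁿp(z⁻¹)`: `|p(z)| = |z|ⁿ|q(z⁻¹)| ≤ |z|ⁿ‖q‖_D = |z|ⁿ‖p‖_D`.
[cite: BorweinErdelyi1995, §5.1 E.17 a] (p. 239)] -/
theorem norm_eval_le_pow_mul {n : ℕ} (hpn : p.natDegree ≤ n) {M : ℝ}
    (hM : ∀ w : ℂ, ‖w‖ = 1 → ‖p.eval w‖ ≤ M) {z : ℂ} (hz : 1 ≤ ‖z‖) :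
    ‖p.eval z‖ ≤ ‖z‖ ^ n * M := by
  have hz0 : z ≠ 0 := by rintro rfl; norm_num at hz
  letI : Invertible z := invertibleOfNonzero hz0
  have key := eval₂_reflect_mul_pow (RingHom.id ℂ) z n p hpn
  rw [invOf_eq_inv, eval₂_id, eval₂_id] at key
  have hq : ‖(p.reflect n).eval z⁻¹‖ ≤ M :=
    norm_eval_le_of_forall_sphere (p := p.reflect n) (fun u hu => norm_reflect_eval_le hpn hM hu)
      (by rw [norm_inv]; exact inv_le_one_of_one_le₀ hz)
  rw [← key, norm_mul, norm_pow, mul_comm]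
  exact mul_le_mul_of_nonneg_left hq (by positivity)

/-- **Exterior Bernstein inequality:** for `p` of degree at most `n` with `|p| ≤ M` on the unit circle,
`|p'(z)| ≤ n·|z|ⁿ⁻¹·M` for every `|z| ≥ 1` (E.17 a] for `p' ∈ 𝒫ₙ₋₁ᶜ`, whose norm on `D` is at most
`nM` by Bernstein's inequality, Cor. 5.1.6).
[cite: BorweinErdelyi1995, §5.1 E.17 a] (p. 239) and Cor. 5.1.6 (p. 233)] -/
theorem norm_derivative_le_pow_mul {n : ℕ} (hpn : p.natDegree ≤ n) {M : ℝ}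
    (hM : ∀ w : ℂ, ‖w‖ = 1 → ‖p.eval w‖ ≤ M) {z : ℂ} (hz : 1 ≤ ‖z‖) :
    ‖p.derivative.eval z‖ ≤ n * ‖z‖ ^ (n - 1) * M := by
  have hd : p.derivative.natDegree ≤ n - 1 :=
    (natDegree_derivative_le p).trans (Nat.sub_le_sub_right hpn 1)
  have hM' : ∀ w : ℂ, ‖w‖ = 1 → ‖p.derivative.eval w‖ ≤ n * M := fun w hw => bernstein hpn hM hw.le
  have := norm_eval_le_pow_mul hd hM' hz
  linarith [this]

/-! ## A5 E.16 d]: the Ankeny–Rivlin inequality -/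

/-- Along a ray: `t ↦ p(t·u)` has derivative `u·p'(t·u)` (real `t`). [folklore] -/
private theorem hasDerivAt_eval_ray (p : ℂ[X]) (u : ℂ) (t : ℝ) :
    HasDerivAt (fun t : ℝ => p.eval ((t : ℂ) * u)) (u * p.derivative.eval ((t : ℂ) * u)) t := by
  have h1 : HasDerivAt (fun w : ℂ => w * u) (1 * u) (t : ℂ) := (hasDerivAt_id (t : ℂ)).mul_const u
  have h2 := HasDerivAt.comp (t : ℂ) (Polynomial.hasDerivAt p ((t : ℂ) * u)) h1
  simp only [Function.comp_def, one_mul] at h2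
  have h3 := h2.comp_ofReal
  convert h3 using 1; ring

/-- **The Ankeny–Rivlin inequality** (Borwein–Erdélyi A5 E.16 d]; Ankeny–Rivlin 1955): if `p` has
degree at most `n`, no zeros in the open unit disk, and `|p| ≤ M` on the unit circle, then for every
`r ≥ 1` and `|z| = r`, `|p(z)| ≤ (rⁿ + 1)/2 · M` (sharp for `p = 1 + zⁿ`). Proof (the book cites [55]):
`p(ru) − p(u) = ∫₁ʳ u·p'(tu) dt` with `|p'(tu)| ≤ (n/2) M tⁿ⁻¹` by Lax's theorem and E.17 a].
[cite: BorweinErdelyi1995, A5 E.16 d] (p. 439)] -/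
theorem ankenyRivlin {n : ℕ} (hpn : p.natDegree ≤ n) (hK : ∀ w ∈ p.roots, 1 ≤ ‖w‖) {M : ℝ}
    (hM : ∀ w : ℂ, ‖w‖ = 1 → ‖p.eval w‖ ≤ M) {r : ℝ} (hr : 1 ≤ r) {z : ℂ} (hz : ‖z‖ = r) :
    ‖p.eval z‖ ≤ (r ^ n + 1) / 2 * M := by
  have hM0 : 0 ≤ M := (norm_nonneg _).trans (hM 1 (by simp))
  have hr0 : 0 < r := lt_of_lt_of_le one_pos hr
  -- `z = r u` with `|u| = 1`
  set u : ℂ := z / r with hu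
  have hu1 : ‖u‖ = 1 := by
    rw [hu, norm_div, Complex.norm_real, Real.norm_eq_abs, abs_of_pos hr0, hz, div_self hr0.ne']
  have hzu : z = (r : ℂ) * u := by
    rw [hu, mul_div_cancel₀]; exact_mod_cast hr0.ne'
  rcases Nat.eq_zero_or_pos n with rfl | hn
  · -- constant polynomial: `|p(z)| ≤ M = (r⁰ + 1)/2 · M`
    have h0 : p.natDegree = 0 := Nat.le_zero.1 hpn
    rw [eq_C_of_natDegree_eq_zero h0, eval_C]
    have := hM 1 (by simp)
    rw [eq_C_of_natDegree_eq_zero h0, eval_C] at this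
    norm_num; exact this
  -- `n ≥ 1`: Lax + exterior growth for `p'`
  have hd : p.derivative.natDegree ≤ n - 1 :=
    (natDegree_derivative_le p).trans (Nat.sub_le_sub_right hpn 1)
  have hLax : ∀ w : ℂ, ‖w‖ = 1 → ‖p.derivative.eval w‖ ≤ n / 2 * M :=
    fun w hw => lax hpn hK hM hw.le
  have hbound : ∀ t : ℝ, t ∈ Set.Icc 1 r →
      ‖u * p.derivative.eval ((t : ℂ) * u)‖ ≤ n / 2 * M * t ^ (n - 1) := by
    intro t ht
    have ht1 : (1 : ℝ) ≤ ‖(t : ℂ) * u‖ := by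
      rw [norm_mul, hu1, mul_one, Complex.norm_real, Real.norm_eq_abs, abs_of_pos (by linarith [ht.1])]
      exact ht.1
    have h := norm_eval_le_pow_mul hd hLax ht1
    rw [norm_mul, hu1, one_mul]
    calc ‖p.derivative.eval ((t : ℂ) * u)‖ ≤ ‖(t : ℂ) * u‖ ^ (n - 1) * (n / 2 * M) := h
      _ = n / 2 * M * t ^ (n - 1) := by
          rw [norm_mul, hu1, mul_one, Complex.norm_real, Real.norm_eq_abs,
            abs_of_pos (by linarith [ht.1])]
          ring
  -- fundamental theorem of calculus on `[1, r]`
  have hderiv : ∀ t ∈ Set.uIcc 1 r,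
      HasDerivAt (fun t : ℝ => p.eval ((t : ℂ) * u)) (u * p.derivative.eval ((t : ℂ) * u)) t :=
    fun t _ => hasDerivAt_eval_ray p u t
  have hcont : Continuous fun t : ℝ => u * p.derivative.eval ((t : ℂ) * u) := by fun_prop
  have hint : IntervalIntegrable (fun t : ℝ => u * p.derivative.eval ((t : ℂ) * u))
      MeasureTheory.volume 1 r := hcont.intervalIntegrable _ _
  have hFTC := integral_eq_sub_of_hasDerivAt hderiv hint
  -- `p(ru) - p(u) = ∫₁ʳ u p'(tu) dt`
  have hdiff : p.eval z - p.eval u = ∫ t in (1 : ℝ)..r, u * p.derivative.eval ((t : ℂ) * u) := by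
    rw [hFTC, hzu]; simp
  -- bound the integral
  have hIle : ‖∫ t in (1 : ℝ)..r, u * p.derivative.eval ((t : ℂ) * u)‖ ≤
      ∫ t in (1 : ℝ)..r, n / 2 * M * t ^ (n - 1) := by
    refine norm_integral_le_of_norm_le hr ?_ ?_
    · exact Filter.Eventually.of_forall fun t ht => hbound t ⟨ht.1.le, ht.2⟩
    · exact (by fun_prop : Continuous fun t : ℝ => n / 2 * M * t ^ (n - 1)).intervalIntegrable _ _
  have hIval : ∫ t in (1 : ℝ)..r, n / 2 * M * t ^ (n - 1) = M * (r ^ n - 1) / 2 := by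
    rw [intervalIntegral.integral_const_mul, integral_pow]
    obtain ⟨m, rfl⟩ := Nat.exists_eq_succ_of_ne_zero hn.ne'
    rw [Nat.succ_sub_one, one_pow]
    push_cast
    field_simp
  calc ‖p.eval z‖ = ‖p.eval u + (p.eval z - p.eval u)‖ := by rw [add_sub_cancel]
    _ ≤ ‖p.eval u‖ + ‖p.eval z - p.eval u‖ := norm_add_le _ _
    _ ≤ M + M * (r ^ n - 1) / 2 := by
        gcongr
        · exact hM u hu1
        · rw [hdiff]; exact hIle.trans_eq hIval
    _ = (r ^ n + 1) / 2 * M := by ring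

/-- Sharpness of the Ankeny–Rivlin inequality: for `p = 1 + zⁿ` (no zeros in `D`, `‖p‖_D = 2`) and
`r ≥ 0`, `|p(r)| = rⁿ + 1 = (rⁿ + 1)/2 · 2`. [cite: BorweinErdelyi1995, A5 E.16 d] (p. 439)] -/
theorem ankenyRivlin_sharp (n : ℕ) {r : ℝ} (hr : 0 ≤ r) :
    ‖(1 + X ^ n : ℂ[X]).eval (r : ℂ)‖ = (r ^ n + 1) / 2 * 2 := by
  simp only [eval_add, eval_one, eval_pow, eval_X]
  rw [show (1 : ℂ) + (r : ℂ) ^ n = ((1 + r ^ n : ℝ) : ℂ) by push_cast; ring, Complex.norm_real,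
    Real.norm_eq_abs, abs_of_nonneg (by positivity)]
  ring

end Literature.Analysis.Complex.PolynomialGrowthUnitDisk

end
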